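import Literature.AlgebraicGeometry.Surfaces.PolarisedK3TwinKuranishiFamily
import Summits.HodgeConjecture.HodgeConjecture.Theses.NikulinTwinTransport

/-!
# Sketch (crux-ideate, ideator 1): first lemmas for three levers on `K3PeriodSurjective`
(stmt-HodgeConjecture-15154).  Definitions + statements; the covering argument of the
orbit-closure lever is kernel-checked (no sorry) to certify that the line CONCLUDES the crux.
-/

noncomputable section

set_option linter.dupNamespace false

open scoped Matrix Topology
open Literature.AlgebraicGeometry Literature.AlgebraicGeometry.Surfaces
  Literature.AlgebraicGeometry.HodgeTheory

namespace Summit.HodgeConjecture.HodgeConjecture.Cruxes.K3PeriodSurjective.IdeatorOne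

/-- The conclusion of the crux at a period vector `x`: `x` is REALISED by a marked projective K3. -/
def Realised (x : K3Index → ℂ) : Prop :=
  ∃ (S : Motives.SchemeOver ℂ) (_ : IsK3Surface S)
    (φ : complexBetti S (2 * 1) ≃ₗ[ℂ] (K3Index → ℂ)) (p : complexBetti S (2 * 2)), IsMarkedK3 S φ p x

/-- A projective period point: `x ∈ D` with an integral `v ⊥ x`, `v² > 0`. -/
def IsProjectivePeriod (x : K3Index → ℂ) : Prop :=
  x ∈ k3PeriodDomain ∧
    ∃ v : K3Index → ℤ, k3Form (fun i => (v i : ℂ)) x = 0 ∧ 0 < ∑ i, ∑ j, v i * k3Gram i j * v j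

/-- The crux, reread: every projective period point is realised (definitional). -/
theorem crux_iff :
    Theses.NikulinTwinTransport.K3PeriodSurjective ↔ ∀ x, IsProjectivePeriod x → Realised x := by
  constructor
  · rintro h x ⟨⟨h1, h2⟩, h3⟩
    exact h x h1 h2 h3
  · intro h x h1 h2 h3
    exact h x ⟨⟨h1, h2⟩, h3⟩

/-! ## Lever A — orbit closures (Ratner–Verbitsky) + Shioda–Inose seeds + local Torelli at CM points -/

/-- The `O(Λ) × ℂˣ`-orbit of a vector (integral isometries as in the tree's
`conclusion_of_latticeIsometry`: `gᵀ Λ g = Λ`, `IsUnit g`). -/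
def orbitCone (x : K3Index → ℂ) : Set (K3Index → ℂ) :=
  {z | ∃ (g : Matrix K3Index K3Index ℤ) (t : ℂ), g.transpose * k3Gram * g = k3Gram ∧ IsUnit g ∧
      t ≠ 0 ∧ z = t • (g.map (Int.cast : ℤ → ℂ) *ᵥ x)}

/-- A CM ("singular K3", `ρ = 20`) period: twenty independent lattice vectors orthogonal to `y`. -/
def IsCMPeriod (y : K3Index → ℂ) : Prop :=
  ∃ N : Fin 20 → (K3Index → ℤ), LinearIndependent ℤ N ∧ ∀ k, k3Form (fun i => (N k i : ℂ)) y = 0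

/-- **T1 (first lemma of lever A; pure homogeneous dynamics, Verbitsky 2015/2017 via Ratner 1991
for `SO⁺(1,19) ⊂ SO⁺(3,19)`):** every `O(Λ_{K3})`-orbit closure in the period domain contains a
CM point. -/
def OrbitClosureMeetsCM : Prop :=
  ∀ x ∈ k3PeriodDomain, ∃ y ∈ closure (orbitCone x), y ∈ k3PeriodDomain ∧ IsCMPeriod y

/-- **T2 (local surjectivity at CM points; Shioda–Inose + Kuranishi local Torelli at ONE explicit
surface + projectivity criterion/GAGA):** around every CM period there is a neighbourhood all of
whose projective period points are realised. -/
def LocallySurjectiveAtCM : Prop :=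
  ∀ y ∈ k3PeriodDomain, IsCMPeriod y → ∃ W ∈ 𝓝 y, ∀ z ∈ W, IsProjectivePeriod z → Realised z

/-- **T3 (in-tree: `conclusion_smul`, `conclusion_of_latticeIsometry`, `hypotheses_*`):** the orbit
action preserves realisability and projectivity (only the directions used below). -/
def OrbitInvariance : Prop :=
  ∀ (x : K3Index → ℂ) (g : Matrix K3Index K3Index ℤ) (t : ℂ),
    g.transpose * k3Gram * g = k3Gram → IsUnit g → t ≠ 0 →
      (IsProjectivePeriod x → IsProjectivePeriod (t • (g.map (Int.cast : ℤ → ℂ) *ᵥ x))) ∧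
      (Realised (t • (g.map (Int.cast : ℤ → ℂ) *ᵥ x)) → Realised x)

/-- The orbit map `w ↦ t • (g w)` is continuous (a `ℂ`-linear map of `ℂ²²`). -/
theorem continuous_orbitMap (g : Matrix K3Index K3Index ℤ) (t : ℂ) :
    Continuous fun w : K3Index → ℂ => t • (g.map (Int.cast : ℤ → ℂ) *ᵥ w) := by
  exact (Continuous.matrix_mulVec continuous_const continuous_id).const_smul t

/-- **The covering argument of lever A, kernel-checked:** T1 + T2 + T3 ⇒ the crux.  (No openness of
the realised set, no closed-set argument, no twistor lines, no degenerations: the orbit of `x`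
accumulates at a CM point `y`; near `y` every projective period is realised; pull back.) -/
theorem crux_of_orbitClosure (h1 : OrbitClosureMeetsCM) (h2 : LocallySurjectiveAtCM)
    (h3 : OrbitInvariance) : Theses.NikulinTwinTransport.K3PeriodSurjective := by
  rw [crux_iff]
  intro x hx
  obtain ⟨y, hycl, hyD, hyCM⟩ := h1 x hx.1
  obtain ⟨W, hW, hWreal⟩ := h2 y hyD hyCM
  obtain ⟨V, hVW, hVo, hyV⟩ := mem_nhds_iff.1 hW
  obtain ⟨z, hzV, g, t, hg, hu, ht, rfl⟩ := mem_closure_iff_nhds.1 hycl V (hVo.mem_nhds hyV)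
  exact (h3 x g t hg hu ht).2 (hWreal _ (hVW hzV) ((h3 x g t hg hu ht).1 hx))

/-! ## Lever B — algebraic properness: Type-I filling of finite-monodromy degenerations (Kulikov / MMP) -/

/-- **(★) Type-I filling, period form (first lemma of lever B):** an `h`-polarised MARKED family of
K3 surfaces over a punctured neighbourhood of a point `b₀` of a smooth curve `B` (marked ⇒ the
monodromy on `H²` is trivial, `MarkedK3Family.transportFun_loop`) whose period vectors converge to a
point `x₀ ∈ D_h` at the puncture REALISES `x₀` (Kulikov–Persson–Pinkham / semistable MMP: the
minimal dlt model has an RDP K3 central fibre; its resolution carries the limit period). -/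
def TypeOneFilling : Prop :=
  ∀ (h : K3Index → ℤ), 0 < ∑ i, ∑ j, h i * k3Gram i j * h j →
    ∀ (𝒮 B : Motives.SchemeOver ℂ) (π : 𝒮 ⟶ B) (U : Set (Motives.ComplexPoints B))
      (F : PolarisedMarkedK3Family π U h) (b₀ : Motives.ComplexPoints B) (x₀ : K3Index → ℂ),
      AlgebraicGeometry.SmoothOfRelativeDimension 1 B.hom →
      b₀ ∉ U → insert b₀ U ∈ 𝓝 b₀ →
      Filter.Tendsto F.period (Filter.comap Subtype.val (𝓝 b₀)) (𝓝 x₀) →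
      x₀ ∈ polarisedPeriodDomain h → Realised x₀

/-- **Polarised openness (shared by levers B and C; in-tree carrier):** every realised `h`-polarised
period sits in an algebraic `h`-polarised Kuranishi family (smooth 19-dim base, local Torelli), so the
realised set is open in `D_h` modulo scalars (`exists_isOpen_forall_exists_period`). -/
def PolarisedKuranishiExists : Prop :=
  ∀ (h : K3Index → ℤ), 0 < ∑ i, ∑ j, h i * k3Gram i j * h j →
    ∀ x ∈ polarisedPeriodDomain h, Realised x →
      ∃ (𝒮 B : Motives.SchemeOver ℂ) (π : 𝒮 ⟶ B) (U : Set (Motives.ComplexPoints B))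
        (F : PolarisedK3KuranishiFamily π U h) (b : U), F.period b = x

/-- The standard vector `e + d f` of square `2d` in the first hyperbolic plane. -/
def stdPol (d : ℤ) : K3Index → ℤ := Sum.elim 0 (Sum.elim ![1, d] 0)

theorem stdPol_sq (d : ℤ) : ∑ i, ∑ j, stdPol d i * k3Gram i j * stdPol d j = 2 * d := by
  simp [stdPol, k3Gram, hyperbolicPlaneGram, Fintype.sum_sum_type, Fin.sum_univ_two]
  ring

/-- **Non-emptiness in every degree (levers B, C):** ONE explicit projective K3 (e.g. a Weierstrass
elliptic K3 with section, `U ⊂ NS ∋ e + d f` for every `d`) realises some `(e + d f)`-polarised period. -/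
def RealisedEveryDegree : Prop :=
  ∀ d : ℤ, 0 < d → ∃ x ∈ polarisedPeriodDomain (stdPol d), Realised x

/-! ## Lever C — metric compactness: non-collapsing Ricci-flat limits (Todorov / Kobayashi–Todorov /
Anderson–BKN / Sun–Zhang §7.2) -/

/-- **Sequential closedness of realised polarised periods (first lemma of lever C):** periods of
marked `h`-polarised K3 surfaces converging INSIDE `D_h` converge to a realised period (unit-volume
Ricci-flat metrics in the class `h` do not collapse when the period limit is interior — integrality of
`h` on the vanishing isotropic cycles — so a subsequence Gromov–Hausdorff converges to an ADE K3
orbifold whose resolution realises `x₀`). -/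
def SequentiallyClosedRealised : Prop :=
  ∀ (h : K3Index → ℤ), 0 < ∑ i, ∑ j, h i * k3Gram i j * h j →
    ∀ (xs : ℕ → K3Index → ℂ) (x₀ : K3Index → ℂ),
      (∀ n, xs n ∈ polarisedPeriodDomain h ∧ Realised (xs n)) →
      Filter.Tendsto xs Filter.atTop (𝓝 x₀) → x₀ ∈ polarisedPeriodDomain h → Realised x₀

end Summit.HodgeConjecture.HodgeConjecture.Cruxes.K3PeriodSurjective.IdeatorOne
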